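import Summits.CriticalPhenomena.PercolationContinuityZ3.Theorems.Transplant.KNCellsBoxProdZ2ConcRootRun
import Summits.CriticalPhenomena.PercolationContinuityZ3.Theorems.Transplant.KNCellsBoxProdZ2ChainRoom
import Summits.CriticalPhenomena.PercolationContinuityZ3.Theorems.Transplant.BoxProdZ2ConcKits
import HarnessLib

/-!
# Design (D), residue (R) plumbing, part 1: the KIT CLAUSES of the root run — the regions of `rootTAD` inside the cut root world `U'` and off
# the wired root cube, the root law `W0sub U'` a subbox weighting of the tube graph on them (`isSubbox_W0sub_tube`), the level / width facts of
# the straight-run cores, and **`hkits_rootTAD`**: the `hkits` hypothesis of `rootOblA_of_rootRun` from p3-g2's kit providers (`kitClauseQ`,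
# `hcon_tube`) with the planar room `TubeAdvData.room` (route scales `ℓ ∈ [ℓ₀, t + R']`)

builds on p205010 (kernel theorem, internal audit signed; external expert review pending) — nothing in this file uses p205010.
Lane `prim-bschramm`, seat `prim-bschramm-p2` ((R) plumbing, lead g3 16:02:38Z (b)); helper file (`--supports stmt-CriticalPhenomena-4575`).

* `rootU` — the cut root world `(Q_0 ∪ E_{0,du}) ∩ (B(w₀,Rt) × ℤ²)`; `rootTAD_stepD_subset_rootU`, `rootTAD_stepD_disjoint_Q`, `isSubbox_rootTAD`;
* `TubeAdvData.level_subset_stepD`, `TubeAdvData.wide`;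
* **`hkits_rootTAD`** — per direction, `∀ k ≤ 44, ∀ j ∈ Icc j₀ j₁`, the kit clause of `RootOblA` / `rootOblA_of_rootRun` for `rootTAD`, from the
  inputs at the running parameter (`hstd` at scale `M`, `hlink` at scales `[ℓ₀, t + R']`), `M + 1 ≤ j₀`, `ψ(t + R') + ψ(M) ≤ L' ≤ Rt`.
[cite: KozmaNitzan2024, §4 p. 28 ((32) at the root), Lemma 10 (pp. 17–21), Lemma 11 (pp. 22–23)]
-/

noncomputable section

open MeasureTheory ProbabilityTheory
open scoped ENNReal Classical

namespace Summit.CriticalPhenomena.PercolationContinuityZ3.Theorems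

namespace Transplant

namespace BoxProdZ2

open Literature.Probability.Percolation Literature.Probability.LatticeModels SimpleGraph GadgetSystem ProbeHistory HSiteScheme Contour KNCells
open Literature.Probability.Percolation.KozmaNitzan
open Literature.Probability.Percolation.KozmaNitzan.Cells (sgOf sgOf_sign)
open Literature.Probability.Percolation.GM
open Literature.Barriers.CriticalPhenomena (mem_graphBall_self)
open KNLevels ChainPlanar

variable {W : Type} [DecidableEq W] (X : SimpleGraph W) [X.LocallyFinite]

/-! ## §1 Levels and widths of a straight run -/

namespace TubeAdvData

omit [DecidableEq W] in
/-- **The levels `j ≤ j₁` of step `k` lie in its region** (`j₁ ≤ Rlev`, `Rlev + 1 ≤ R'`, `k ≤ nA`). [cite: KozmaNitzan2024, §4 Lemma 10 (p. 17: B⟨j⟩ ⊆ D)] -/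
theorem level_subset_stepD (P : TubeAdvData W) (hsg : P.sg = 1 ∨ P.sg = -1) (hOK : Adv.AdvOK P.q P.q' P.s₁ P.ρ P.R' P.ℓ₀ P.nA)
    (hRl : P.Rlev + 1 ≤ P.R') (hj : P.j₁ ≤ P.Rlev) {k : ℕ} (hk : k ≤ P.nA) {j : ℕ} (hjj : j ≤ P.j₁) :
    tubeLevel P.π (P.alo k) (P.ahi k) j ⊆ P.π ×ˢ P.aregion k := by
  rw [tubeLevel, TubeAdvData.alo, TubeAdvData.ahi, sBox_enlarge _ _ hsg]
  have hjR : (j : ℤ) ≤ P.R' := by exact_mod_cast (hjj.trans hj).trans (by omega : P.Rlev ≤ P.R')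
  exact Finset.product_subset_product_right
    ((sBox_mono hsg _ (by linarith) (by linarith) (by linarith)).trans (Adv.enlarge_core_subset_region hsg _ hOK hk))

omit [DecidableEq W] in
/-- **Every level `j ≥ M + 1` of every core of a straight run is at least `2M + 2` wide in each coordinate.** [folklore] -/
theorem wide (P : TubeAdvData W) (hsg : P.sg = 1 ∨ P.sg = -1) (hOK : Adv.AdvOK P.q P.q' P.s₁ P.ρ P.R' P.ℓ₀ P.nA) (k : ℕ) {M j : ℕ}
    (hMj : M + 1 ≤ j) : ∀ i, (P.alo k - ((j : ℕ) : Site 2)) i + 2 * M + 2 ≤ (P.ahi k + ((j : ℕ) : Site 2)) i := by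
  intro i
  have hne := Adv.core_nonempty hsg P.c hOK k (q := P.q) (q' := P.q') (s₁ := P.s₁) (R' := P.R') (a := P.ax)
  have hle : P.alo k ≤ P.ahi k := Finset.nonempty_Icc.1 hne
  have hk := hle i
  have hMj' : (M : ℤ) + 1 ≤ j := by exact_mod_cast hMj
  simp only [Pi.sub_apply, Pi.add_apply, Pi.natCast_apply]
  linarith

end TubeAdvData

/-! ## §2 The root run inside the cut root world -/

/-- **The cut root world** of direction `du`: `(Q_0 ∪ E_{0,du}) ∩ (B_X(w₀, Rt) × ℤ²)`. [cite: KozmaNitzan2024, §4 p. 28 ((32) at the root)] -/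
def rootU (C : PCells) (w₀ : W) (Λ : ConcRadiiG) (q : unitInterval) (δc : ℝ) (Rt : ℕ) (du : MDir) : Finset (W × Site 2) :=
  ((concSchemeG X C w₀ Λ q δc).U0root du).filter fun y => y.1 ∈ ballFin X w₀ Rt

section Root

variable {C : PCells} {w₀ : W} {Λ : ConcRadiiG} {q : unitInterval} {δc : ℝ} {Rt L' t R' ℓ₀ Rlev N j₀ j₁ : ℕ} {du : MDir} {ca cb q' : ℤ}

/-- **Every region of the root run lies in the cut root world** (radius facts `Rt ≤ rB 0 0 du`, `Rt ≤ rQ 0 (0 + du)`).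
[cite: KozmaNitzan2024, §4 p. 28] -/
theorem rootTAD_stepD_subset_rootU (h : RootRunOK C t R' ℓ₀ ca cb q') (hRB : Rt ≤ Λ.rB 0 0 du) (hRQ : Rt ≤ Λ.rQ 0 ((0 : Site 2) + stepVec du))
    {k : ℕ} (hk : k ≤ 44) :
    (rootTAD X w₀ Rt L' du t R' ℓ₀ ca cb q' Rlev N j₀ j₁ (rootU X C w₀ Λ q δc Rt du)).stepD k ⊆ rootU X C w₀ Λ q δc Rt du := by
  intro v hv
  obtain ⟨hv1, hv2⟩ := Finset.mem_product.1 hv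
  refine Finset.mem_filter.2 ⟨?_, hv1⟩
  rcases Finset.mem_union.1 (rootRun_region_subset h hk hv2) with hv2 | hv2
  · refine Finset.mem_union_right _ (Finset.mem_union_left _ ?_)
    change v ∈ ballFin X w₀ (Λ.rB 0 0 du) ×ˢ C.Btw 0 du
    exact Finset.mem_product.2 ⟨ballFin_mono X w₀ hRB hv1, hv2⟩
  · refine Finset.mem_union_right _ (Finset.mem_union_right _ ?_)
    change v ∈ ballFin X w₀ (Λ.rQ 0 ((0 : Site 2) + stepVec du)) ×ˢ C.Q ((0 : Site 2) + stepVec du)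
    exact Finset.mem_product.2 ⟨ballFin_mono X w₀ hRQ hv1, hv2⟩

/-- **Every region of the root run is off the wired root cube.** [cite: KozmaNitzan2024, §4 p. 28] -/
theorem rootTAD_stepD_disjoint_Q (h : RootRunOK C t R' ℓ₀ ca cb q') {k : ℕ} (hk : k ≤ 44) {Sfin : Finset (W × Site 2)} :
    Disjoint ((rootTAD X w₀ Rt L' du t R' ℓ₀ ca cb q' Rlev N j₀ j₁ Sfin).stepD k) ((concSchemeG X C w₀ Λ q δc).Γ.Q (concSchemeG X C w₀ Λ q δc).Γ.a₀ 0) := by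
  change Disjoint (ballFin X w₀ Rt ×ˢ _) (ballFin X w₀ (Λ.rQ 0 0) ×ˢ C.Q 0)
  exact disjoint_product_of_right (rootRun_region_disjoint_Q h hk)

/-- **The root law cut to the tube is a subbox weighting of the tube graph on every region of the root run.**
[cite: KozmaNitzan2024, §4 p. 17 (subbox), p. 28] -/
theorem isSubbox_rootTAD (h : RootRunOK C t R' ℓ₀ ca cb q') (hRB : Rt ≤ Λ.rB 0 0 du) (hRQ : Rt ≤ Λ.rQ 0 ((0 : Site 2) + stepVec du))
    {k : ℕ} (hk : k ≤ 44) :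
    KNLevels.IsSubbox (tubeGraph X (ballFin X w₀ Rt)) ((concSchemeG X C w₀ Λ q δc).W0sub (X □ zdGraph 2) (rootU X C w₀ Λ q δc Rt du)) q
      ((rootTAD X w₀ Rt L' du t R' ℓ₀ ca cb q' Rlev N j₀ j₁ (rootU X C w₀ Λ q δc Rt du)).stepD k) :=
  KSchA.isSubbox_W0sub_tube X (S := concSchemeG X C w₀ Λ q δc) (ballFin X w₀ Rt) (U := (concSchemeG X C w₀ Λ q δc).U0root du)
    (rootTAD_stepD_subset_rootU X h hRB hRQ hk) (rootTAD_stepD_disjoint_Q X h hk)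

/-! ## §3 The kit clauses of the root run -/

/-- **THE KIT CLAUSES OF THE ROOT RUN** (`hkits` of `rootOblA_of_rootRun` at direction `du`): for every step `k ≤ 44` and level
`j ∈ [j₀, j₁]`, p3-g2's `kitClauseQ` with the rim / deep dichotomy `hcon_tube`, rooms from `TubeAdvData.room` (scales `ℓ ∈ [ℓ₀, t + R']`).
[cite: KozmaNitzan2024, §4 Lemma 10 (pp. 17–21), Lemma 11 (pp. 22–23), p. 28] -/
theorem hkits_rootTAD [Countable W] (h : RootRunOK C t R' ℓ₀ ca cb q') (hRB : Rt ≤ Λ.rB 0 0 du)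
    (hRQ : Rt ≤ Λ.rQ 0 ((0 : Site 2) + stepVec du)) (hRl : Rlev + 1 ≤ R') (hj : j₁ ≤ Rlev)
    {Δ : ℕ} (hΔ : ∀ w, X.degree w ≤ Δ) {p₀ : unitInterval} (hT : TubeSubcritical X p₀) (V₀ : Finset W) (hfr : ∀ w : W, ∃ γ : X ≃g X, γ w ∈ V₀)
    {δ : ℝ} (hδ : 0 < δ) {msel : W → ℕ} {M : ℕ} (hmsel : ∀ τ ∈ V₀, msel τ ≤ M)
    (hstd : ∀ τ ∈ V₀,
      1 - δ ^ 2 < (bondPercolation (X □ zdGraph 2) q).real (UniqZone.zone (X □ zdGraph 2) (ufatSeq X hT V₀ τ) (msel τ) M) ∧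
      ∀ g : HOct 2, 1 - δ ^ 2 < (bondPercolation (X □ zdGraph 2) q).real
        (linkIn (↑(ufatSeq X hT V₀ τ M)) (ufatSeq X hT V₀ τ (msel τ)) (ballFin X τ (ufatRadius X hT V₀ M) ×ˢ piece g M)))
    (hMℓ : M < ℓ₀)
    (hlink : ∀ ℓ, ℓ₀ ≤ ℓ → ℓ ≤ t + R' → ∀ τ ∈ V₀, ∀ g : HOct 2, 1 - δ ^ 2 < (bondPercolation (X □ zdGraph 2) q).real
      (linkIn (↑(ufatSeq X hT V₀ τ ℓ)) (ufatSeq X hT V₀ τ (msel τ)) (ballFin X τ (ufatRadius X hT V₀ ℓ) ×ˢ piece g ℓ)))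
    (hnF : ufatRadius X hT V₀ M ≤ Rt) (hLψ : ufatRadius X hT V₀ (t + R') + ufatRadius X hT V₀ M ≤ L') (hLR : L' ≤ Rt)
    (hj₀ : M + 1 ≤ j₀) (kk : ℕ) (hN : kk * kitB Δ M (ufatRadius X hT V₀ M) ≤ N) (hk : (1 - (q : ℝ) ^ kitSB Δ M (ufatRadius X hT V₀ M)) ^ kk ≤ δ) :
    ∀ k ≤ 44, ∀ j ∈ Finset.Icc j₀ j₁,
      ∃ (σ : KNLevels.SData (W × Site 2)) (Sz : Finset (W × Site 2)),
      KNLevels.SHyp (tubeLData X (rootTAD X w₀ Rt L' du t R' ℓ₀ ca cb q' Rlev N j₀ j₁ (rootU X C w₀ Λ q δc Rt du)).π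
        ((rootTAD X w₀ Rt L' du t R' ℓ₀ ca cb q' Rlev N j₀ j₁ (rootU X C w₀ Λ q δc Rt du)).alo k)
        ((rootTAD X w₀ Rt L' du t R' ℓ₀ ca cb q' Rlev N j₀ j₁ (rootU X C w₀ Λ q δc Rt du)).ahi k)
        (rootTAD X w₀ Rt L' du t R' ℓ₀ ca cb q' Rlev N j₀ j₁ (rootU X C w₀ Λ q δc Rt du)).root
        (rootTAD X w₀ Rt L' du t R' ℓ₀ ca cb q' Rlev N j₀ j₁ (rootU X C w₀ Λ q δc Rt du)).Sfin) j σ ∧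
      σ.N ≤ (rootTAD X w₀ Rt L' du t R' ℓ₀ ca cb q' Rlev N j₀ j₁ (rootU X C w₀ Λ q δc Rt du)).N ∧
      (1 - (q : ℝ) ^ σ.sB) ^ σ.k ≤ δ ∧
      Sz ⊆ (tubeLData X (rootTAD X w₀ Rt L' du t R' ℓ₀ ca cb q' Rlev N j₀ j₁ (rootU X C w₀ Λ q δc Rt du)).π
        ((rootTAD X w₀ Rt L' du t R' ℓ₀ ca cb q' Rlev N j₀ j₁ (rootU X C w₀ Λ q δc Rt du)).alo k)
        ((rootTAD X w₀ Rt L' du t R' ℓ₀ ca cb q' Rlev N j₀ j₁ (rootU X C w₀ Λ q δc Rt du)).ahi k)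
        (rootTAD X w₀ Rt L' du t R' ℓ₀ ca cb q' Rlev N j₀ j₁ (rootU X C w₀ Λ q δc Rt du)).root
        (rootTAD X w₀ Rt L' du t R' ℓ₀ ca cb q' Rlev N j₀ j₁ (rootU X C w₀ Λ q δc Rt du)).Sfin).X j ∧
      Sz ⊆ (rootTAD X w₀ Rt L' du t R' ℓ₀ ca cb q' Rlev N j₀ j₁ (rootU X C w₀ Λ q δc Rt du)).stepD k ∧
      (∀ x ∈ σ.K, ∀ e' ∈ σ.seed x, e' ∉ wireSet (↑Sz : Set (W × Site 2))) ∧ (∀ x ∈ σ.K, σ.face x ⊆ Sz) ∧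
      (∀ x ∈ σ.K, 1 - 3 * δ ≤ (prodBernoulli ((concSchemeG X C w₀ Λ q δc).W0sub (X □ zdGraph 2) (rootU X C w₀ Λ q δc Rt du))).real
        {ω | ∃ u ∈ σ.face x,
        1 - δ < (prodBernoulli (pinW ((concSchemeG X C w₀ Λ q δc).W0sub (X □ zdGraph 2) (rootU X C w₀ Λ q δc Rt du))
          (wireSet (↑Sz : Set (W × Site 2))) ω)).real
          (⋃ z ∈ (rootTAD X w₀ Rt L' du t R' ℓ₀ ca cb q' Rlev N j₀ j₁ (rootU X C w₀ Λ q δc Rt du)).coreE k,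
            openConnIn (↑((rootTAD X w₀ Rt L' du t R' ℓ₀ ca cb q' Rlev N j₀ j₁ (rootU X C w₀ Λ q δc Rt du)).stepD k) : Set (W × Site 2)) u z)}) := by
  set P := rootTAD X w₀ Rt L' du t R' ℓ₀ ca cb q' Rlev N j₀ j₁ (rootU X C w₀ Λ q δc Rt du) with hP
  have hsg : P.sg = 1 ∨ P.sg = -1 := sgOf_sign du
  have hOK : Adv.AdvOK P.q P.q' P.s₁ P.ρ P.R' P.ℓ₀ P.nA := rootRun_advOK h
  intro k hkA j hjj
  have hj₁ : j ≤ j₁ := (Finset.mem_Icc.1 hjj).2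
  have hjM : M + 1 ≤ j := hj₀.trans (Finset.mem_Icc.1 hjj).1
  have hwide := TubeAdvData.wide P hsg hOK k hjM
  have hWD : IsSubbox (tubeGraph X (ballFin X w₀ Rt)) _ q (ballFin X w₀ Rt ×ˢ P.aregion k) := isSubbox_rootTAD X h hRB hRQ hkA
  have hXD : tubeLevel (ballFin X w₀ Rt) (P.alo k) (P.ahi k) j ⊆ ballFin X w₀ Rt ×ˢ P.aregion k :=
    TubeAdvData.level_subset_stepD P hsg hOK hRl hj hkA hj₁
  have hTpl : ballFin X w₀ Rt ×ˢ P.acore (k + 1) ⊆ P.coreE k := Finset.subset_union_left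
  have hRimT : P.Rim k ⊆ P.coreE k := Finset.subset_union_right
  have hRim : (ballFin X w₀ Rt \ ballFin X w₀ (Rt - L')) ×ˢ P.aregion k ⊆ P.Rim k := subset_rfl
  refine kitClauseQ X hΔ hT V₀ hδ hmsel hstd hnF hwide kk P.root P.Sfin hWD hXD hN hk fun x hx => ?_
  -- the planar room at the contact's cube centre: a route scale `ℓ ∈ [ℓ₀, t + R']` (`2q + s₁ + R'` with `q = 0`, `s₁ = t`)
  obtain ⟨ℓ, hℓ₀, hℓ₁, hroomD, a, τ', hroomT⟩ :=
    TubeAdvData.room P hsg hOK hRl hj (ℓ₁ := t + R') (by change 2 * (0 : ℤ) + (t : ℤ) + R' ≤ ((t + R' : ℕ) : ℤ); push_cast; linarith) hkA j hj₁ _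
      (vctr_mem_level X hwide hx)
  have hψ : ufatRadius X hT V₀ ℓ + ufatRadius X hT V₀ M ≤ L' := (Nat.add_le_add_right (ufatRadius_mono X hT V₀ hℓ₁) _).trans hLψ
  exact hcon_tube X hT V₀ hfr (lt_of_lt_of_le hMℓ hℓ₀) (hlink ℓ hℓ₀ hℓ₁) hnF hψ hLR hwide hWD hXD hTpl hRimT hRim hx hroomD hroomT

end Root

end BoxProdZ2

end Transplant

end Summit.CriticalPhenomena.PercolationContinuityZ3.Theorems

end
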